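import Mathlib
import Literature.Analysis.FluidPDE.GaussianVortexPlanar
import Literature.Analysis.FluidPDE.GaussianVortexPlanarProofs
import Literature.Analysis.UnboundedOperators.HeatKernelDirichletForm
import Literature.Analysis.FunctionSpaces.BMOCarlesonProofs
import HarnessLib

/-!
# Helper `coreL_second_moment` toward stub `stub_coreInverse` of the line `braid-closed-large-circulation-gluing`
# (crux stmt-AnomalousDissipation-3009, `MarginalStabilityChain.StretchedVortexRows`)

The Gaussian second moment of a ground-state profile is controlled by the Dirichlet form of the core operator:
for `u ∈ C¹(ℝ²)` with `u, Du` bounded and `G = gaussVortexProfile = (4π)⁻¹e^{−|ξ|²/4}`,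

  `∫ |ξ|² u² G ≤ 16 ∫ G ‖Du‖² + 8 ∫ G u²`      (`coreL_second_moment`),

the moment bound needed to control Gallay–Wayne's `Y`-norm of `w = G u` (`∇w = G(∇u − uξ/2)`).
Proof: `ξᵢ G = −2 ∂ᵢG`, so one whole-space integration by parts per coordinate
(`integral_mul_fderiv_eq_neg_fderiv_mul_of_integrable`) gives the virial identity
`½ ∫ ξᵢ² u² G = ∫ (2u ∂ᵢu ξᵢ + u²) G`; summing, `½∫|ξ|²u²G = ∫ (2u Du[ξ] + 2u²) G`, and Young's inequality
`2u Du[ξ] ≤ ¼|ξ|²u² + 4‖Du‖²` closes the bound. All integrands are continuous and dominated by `(1+|ξ|)² G`,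
integrable by the tree's heat-kernel weight bounds (`G = 16π Γ₂²`, `exists_bound_one_add_norm_pow_mul_heatKernel`).

References: Th. Gallay, Y. Maekawa, arXiv:1610.08384, §4.1 (moment weights); D. Bakry, I. Gentil, M. Ledoux,
*Analysis and Geometry of Markov Diffusion Operators*, §2.7.1 (Ornstein–Uhlenbeck integration by parts).
-/

set_option linter.dupNamespace false

noncomputable section

open scoped RealInnerProductSpace Topology
open MeasureTheory WithLp Function Filter

namespace Summit.AnomalousDissipation.AnomalousDissipation.Theorems.MarginalStabilityChainStretchedVortexRows

open Literature.Analysis.FluidPDE Literature.Analysis.UnboundedOperators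

/-! ### Gaussian moments -/

/-- `G = 16π Γ₂²`: the Gaussian vortex profile is `16π` times the square of the heat kernel of `ℝ²` at time `2`
(private copy of the lemma of the helper module `…StubCoreRotationLocalSkew`). [folklore] -/
private theorem gauss_eq_mul_heatKernel_two_sq (z : EuclideanSpace ℝ (Fin 2)) :
    gaussVortexProfile z = 16 * Real.pi * heatKernel (E := EuclideanSpace ℝ (Fin 2)) 2 z ^ 2 := by
  rw [gaussVortexProfile, heatKernel_eq, finrank_euclideanSpace_fin]
  have h1 : ((4 : ℝ) * Real.pi * 2) ^ (-((2 : ℕ) : ℝ) / 2) = (8 * Real.pi)⁻¹ := by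
    rw [show (-((2 : ℕ) : ℝ) / 2) = -1 by norm_num, Real.rpow_neg_one]; ring
  rw [h1, mul_pow, ← Real.exp_nat_mul]
  have h2 : ((2 : ℕ) : ℝ) * (-(1 / (4 * 2)) * ‖z‖ ^ 2) = -(‖z‖ ^ 2 / 4) := by push_cast; ring
  rw [h2]
  field_simp
  norm_num

/-- **Polynomial moments of the Gaussian**: `(1 + |z|)^N G(z)` is integrable for every `N`
(private copy of the lemma of the helper module `…StubCoreRotationLocalSkew`). [folklore] -/
private theorem integrable_one_add_norm_pow_mul_gauss (N : ℕ) :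
    Integrable fun z : EuclideanSpace ℝ (Fin 2) => (1 + ‖z‖) ^ N * gaussVortexProfile z := by
  obtain ⟨C, hC⟩ := Literature.Analysis.FunctionSpaces.BMOInv.exists_bound_one_add_norm_pow_mul_heatKernel
    (E := EuclideanSpace ℝ (Fin 2)) (t := 2) two_pos 0 N
  have hK : ∀ z : EuclideanSpace ℝ (Fin 2),
      Literature.Analysis.FunctionSpaces.BMOInv.heatKernel (E := EuclideanSpace ℝ (Fin 2)) 2 (0 - z) = heatKernel 2 z := by
    intro z
    change heatKernel (E := EuclideanSpace ℝ (Fin 2)) 2 (0 - z) = heatKernel 2 z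
    rw [heatKernel_eq, heatKernel_eq, zero_sub, norm_neg]
  have hint : Integrable fun z : EuclideanSpace ℝ (Fin 2) => (16 * Real.pi * C) * heatKernel 2 z :=
    (integrable_heatKernel_holds two_pos).const_mul _
  refine hint.mono' ?_ (Eventually.of_forall fun z => ?_)
  · exact (((continuous_const.add continuous_norm).pow N).mul
      (contDiff_gaussVortexProfile (n := 0)).continuous).aestronglyMeasurable
  have hKpos : 0 < heatKernel (E := EuclideanSpace ℝ (Fin 2)) 2 z := heatKernel_pos two_pos z
  have hb := hC z
  rw [hK] at hb
  rw [Real.norm_of_nonneg (mul_nonneg (by positivity) (gaussVortexProfile_pos z).le),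
    gauss_eq_mul_heatKernel_two_sq]
  calc (1 + ‖z‖) ^ N * (16 * Real.pi * heatKernel 2 z ^ 2)
      = 16 * Real.pi * ((1 + ‖z‖) ^ N * heatKernel 2 z) * heatKernel 2 z := by ring
    _ ≤ 16 * Real.pi * C * heatKernel 2 z := by gcongr

/-- Integrability against the Gaussian class: a continuous `F` with `|F(z)| ≤ A (1 + |z|)² G(z)` is integrable. [folklore] -/
theorem integrable_of_abs_le_mul_gauss {F : EuclideanSpace ℝ (Fin 2) → ℝ} (hF : Continuous F)
    (A : ℝ) (hle : ∀ z, |F z| ≤ A * ((1 + ‖z‖) ^ 2 * gaussVortexProfile z)) : Integrable F :=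
  ((integrable_one_add_norm_pow_mul_gauss 2).const_mul A).mono' hF.aestronglyMeasurable
    (Eventually.of_forall fun z => by rw [Real.norm_eq_abs]; exact hle z)

/-- Elementary polynomial bounds: `1, r, r² ≤ (1 + r)²` for `r ≥ 0`. [folklore] -/
theorem le_one_add_sq_of_nonneg {r : ℝ} (hr : 0 ≤ r) :
    1 ≤ (1 + r) ^ 2 ∧ r ≤ (1 + r) ^ 2 ∧ r ^ 2 ≤ (1 + r) ^ 2 := by
  refine ⟨by nlinarith, by nlinarith, by nlinarith⟩

/-- `∂ᵢG(x) = −(xᵢ/2) G(x)` along the coordinate directions (private copy of the `…Tools` lemma). [folklore] -/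
private theorem fderiv_gauss_single (x : EuclideanSpace ℝ (Fin 2)) (i : Fin 2) :
    fderiv ℝ gaussVortexProfile x (EuclideanSpace.single i 1) = -(x i / 2) * gaussVortexProfile x := by
  rw [fderiv_gaussVortexProfile_apply, EuclideanSpace.inner_single_right]
  simp only [one_mul, conj_trivial]
  ring

/-- `Du(x)[x] = x₀ ∂₀u(x) + x₁ ∂₁u(x)` on `ℝ²` (private copy of the `…Tools` lemma). [folklore] -/
private theorem fderiv_apply_self_eq_coord' (u : EuclideanSpace ℝ (Fin 2) → ℝ) (x : EuclideanSpace ℝ (Fin 2)) :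
    fderiv ℝ u x x = x 0 * fderiv ℝ u x (EuclideanSpace.single 0 1) +
      x 1 * fderiv ℝ u x (EuclideanSpace.single 1 1) := by
  rw [← sum_inner_mul_apply_orthonormalBasis (EuclideanSpace.basisFun (Fin 2) ℝ) (fderiv ℝ u x) x]
  simp [Fin.sum_univ_two, EuclideanSpace.basisFun_apply, EuclideanSpace.inner_single_right]

/-! ### The three basic Gaussian integrands of the energy method -/

section Basic

variable {u : EuclideanSpace ℝ (Fin 2) → ℝ} (hu : ContDiff ℝ 1 u) {M : ℝ}
  (h0 : ∀ x, |u x| ≤ M) (h1 : ∀ x, ‖fderiv ℝ u x‖ ≤ M)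
include hu

include h0 in
/-- `|ξ|² u² G` is integrable for `C¹` bounded `u`. [folklore] -/
theorem integrable_norm_sq_mul_sq_mul_gauss :
    Integrable fun x : EuclideanSpace ℝ (Fin 2) => ‖x‖ ^ 2 * u x ^ 2 * gaussVortexProfile x := by
  refine integrable_of_abs_le_mul_gauss (((continuous_norm.pow 2).mul (hu.continuous.pow 2)).mul
    (contDiff_gaussVortexProfile (n := 0)).continuous) (M ^ 2) fun x => ?_
  have hux : u x ^ 2 ≤ M ^ 2 := by
    rw [← sq_abs]; exact pow_le_pow_left₀ (abs_nonneg _) (h0 x) 2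
  rw [abs_of_nonneg (by positivity [gaussVortexProfile_pos x])]
  obtain ⟨-, -, h3⟩ := le_one_add_sq_of_nonneg (norm_nonneg x)
  calc ‖x‖ ^ 2 * u x ^ 2 * gaussVortexProfile x ≤ (1 + ‖x‖) ^ 2 * M ^ 2 * gaussVortexProfile x :=
        mul_le_mul_of_nonneg_right (mul_le_mul h3 hux (sq_nonneg _) (by positivity)) (gaussVortexProfile_pos x).le
    _ = M ^ 2 * ((1 + ‖x‖) ^ 2 * gaussVortexProfile x) := by ring

include h1 in
/-- `G ‖Du‖²` is integrable for `C¹` `u` with `Du` bounded. [folklore] -/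
theorem integrable_gauss_mul_norm_fderiv_sq :
    Integrable fun x : EuclideanSpace ℝ (Fin 2) => gaussVortexProfile x * ‖fderiv ℝ u x‖ ^ 2 := by
  refine integrable_of_abs_le_mul_gauss ((contDiff_gaussVortexProfile (n := 0)).continuous.mul
    ((hu.continuous_fderiv one_ne_zero).norm.pow 2)) (M ^ 2) fun x => ?_
  have hux : ‖fderiv ℝ u x‖ ^ 2 ≤ M ^ 2 := pow_le_pow_left₀ (norm_nonneg _) (h1 x) 2
  rw [abs_of_nonneg (by positivity [gaussVortexProfile_pos x])]
  obtain ⟨h3, -, -⟩ := le_one_add_sq_of_nonneg (norm_nonneg x)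
  calc gaussVortexProfile x * ‖fderiv ℝ u x‖ ^ 2 ≤ gaussVortexProfile x * M ^ 2 :=
        mul_le_mul_of_nonneg_left hux (gaussVortexProfile_pos x).le
    _ = M ^ 2 * (1 * gaussVortexProfile x) := by ring
    _ ≤ M ^ 2 * ((1 + ‖x‖) ^ 2 * gaussVortexProfile x) :=
        mul_le_mul_of_nonneg_left (mul_le_mul_of_nonneg_right h3 (gaussVortexProfile_pos x).le) (sq_nonneg M)

include h0 in
/-- `G u²` is integrable for `C¹` bounded `u`. [folklore] -/
theorem integrable_gauss_mul_sq :
    Integrable fun x : EuclideanSpace ℝ (Fin 2) => gaussVortexProfile x * u x ^ 2 := by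
  refine integrable_of_abs_le_mul_gauss ((contDiff_gaussVortexProfile (n := 0)).continuous.mul
    (hu.continuous.pow 2)) (M ^ 2) fun x => ?_
  have hux : u x ^ 2 ≤ M ^ 2 := by
    rw [← sq_abs]; exact pow_le_pow_left₀ (abs_nonneg _) (h0 x) 2
  rw [abs_of_nonneg (by positivity [gaussVortexProfile_pos x])]
  obtain ⟨h3, -, -⟩ := le_one_add_sq_of_nonneg (norm_nonneg x)
  calc gaussVortexProfile x * u x ^ 2 ≤ gaussVortexProfile x * M ^ 2 :=
        mul_le_mul_of_nonneg_left hux (gaussVortexProfile_pos x).le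
    _ = M ^ 2 * (1 * gaussVortexProfile x) := by ring
    _ ≤ M ^ 2 * ((1 + ‖x‖) ^ 2 * gaussVortexProfile x) :=
        mul_le_mul_of_nonneg_left (mul_le_mul_of_nonneg_right h3 (gaussVortexProfile_pos x).le) (sq_nonneg M)

end Basic

/-! ### The Gaussian second-moment bound -/

/-- **Gaussian second moment controlled by the Dirichlet form**: for `u ∈ C¹(ℝ²)` with `u, Du` bounded,
`∫ |x|² u² G ≤ 16 ∫ G ‖Du‖² + 8 ∫ G u²`. Proof: `xᵢ G = −2∂ᵢG`, so one integration by parts per coordinate gives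
the virial identity `½∫ xᵢ² u² G = ∫ (2u ∂ᵢu xᵢ + u²) G`; summing, `½∫|x|²u²G = ∫ (2u Du[x] + 2u²) G`, and
`2u Du[x] ≤ ¼|x|²u² + 4‖Du‖²`. [folklore] -/
theorem integral_norm_sq_mul_sq_mul_gaussVortexProfile_le {u : EuclideanSpace ℝ (Fin 2) → ℝ}
    (hu : ContDiff ℝ 1 u) {M : ℝ} (h0 : ∀ x, |u x| ≤ M) (h1 : ∀ x, ‖fderiv ℝ u x‖ ≤ M) :
    ∫ x, ‖x‖ ^ 2 * u x ^ 2 * gaussVortexProfile x ≤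
      16 * (∫ x, gaussVortexProfile x * ‖fderiv ℝ u x‖ ^ 2) + 8 * ∫ x, gaussVortexProfile x * u x ^ 2 := by
  have hGpos : ∀ x, 0 < gaussVortexProfile x := gaussVortexProfile_pos
  have hGc : Continuous gaussVortexProfile := (contDiff_gaussVortexProfile (n := 0)).continuous
  have hGd : ∀ x, HasFDerivAt gaussVortexProfile (fderiv ℝ gaussVortexProfile x) x := fun x =>
    ((contDiff_gaussVortexProfile (n := 1)).differentiable one_ne_zero x).hasFDerivAt
  have hM : 0 ≤ M := (abs_nonneg _).trans (h0 0)
  have huc : Continuous u := hu.continuous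
  have hud : ∀ x, HasFDerivAt u (fderiv ℝ u x) x := fun x => (hu.differentiable one_ne_zero x).hasFDerivAt
  have hu1c : ∀ i : Fin 2, Continuous fun x => fderiv ℝ u x (EuclideanSpace.single i 1) := fun i =>
    (hu.continuous_fderiv one_ne_zero).clm_apply continuous_const
  have hDuc : Continuous fun x => ‖fderiv ℝ u x‖ := (hu.continuous_fderiv one_ne_zero).norm
  have hxi : ∀ (x : EuclideanSpace ℝ (Fin 2)) (i : Fin 2), |x i| ≤ ‖x‖ := fun x i => by
    simpa [Real.norm_eq_abs] using PiLp.norm_apply_le x i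
  have hb1 : ∀ x (i : Fin 2), |fderiv ℝ u x (EuclideanSpace.single i 1)| ≤ M := fun x i => by
    rw [← Real.norm_eq_abs]
    refine ((fderiv ℝ u x).le_opNorm _).trans ?_
    rw [PiLp.norm_single, norm_one, mul_one]
    exact h1 x
  have hDux : ∀ x, |fderiv ℝ u x x| ≤ ‖fderiv ℝ u x‖ * ‖x‖ := fun x => by
    rw [← Real.norm_eq_abs]; exact (fderiv ℝ u x).le_opNorm x
  -- integrability of the basic integrands
  have iM := integrable_norm_sq_mul_sq_mul_gauss hu h0
  have iA := integrable_gauss_mul_norm_fderiv_sq hu h1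
  have iB := integrable_gauss_mul_sq hu h0
  -- the virial identity, one coordinate at a time
  have iR : ∀ i : Fin 2, Integrable fun x =>
      (2 * u x * fderiv ℝ u x (EuclideanSpace.single i 1) * x i + u x ^ 2) * gaussVortexProfile x := by
    intro i
    refine integrable_of_abs_le_mul_gauss (((((continuous_const.mul huc).mul (hu1c i)).mul
      (PiLp.continuous_apply 2 _ i)).add (huc.pow 2)).mul hGc) (3 * M ^ 2) fun x => ?_
    rw [abs_mul, abs_of_pos (hGpos x)]
    have e1 : |u x| * |fderiv ℝ u x (EuclideanSpace.single i 1)| ≤ M * M :=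
      mul_le_mul (h0 x) (hb1 x i) (abs_nonneg _) hM
    have e2 : |u x| * |fderiv ℝ u x (EuclideanSpace.single i 1)| * |x i| ≤ M * M * ‖x‖ :=
      mul_le_mul e1 (hxi x i) (abs_nonneg _) (by positivity)
    have e3 : |2 * u x * fderiv ℝ u x (EuclideanSpace.single i 1) * x i + u x ^ 2| ≤
        2 * (M * M * ‖x‖) + M * M := by
      refine (abs_add_le _ _).trans ?_
      rw [abs_mul, abs_mul, abs_mul, abs_two, abs_pow, sq_abs]
      have : u x ^ 2 ≤ M * M := by nlinarith [abs_le.1 (h0 x), sq_abs (u x)]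
      nlinarith
    obtain ⟨h3, h4, -⟩ := le_one_add_sq_of_nonneg (norm_nonneg x)
    calc |2 * u x * fderiv ℝ u x (EuclideanSpace.single i 1) * x i + u x ^ 2| * gaussVortexProfile x
        ≤ (2 * (M * M * ‖x‖) + M * M) * gaussVortexProfile x :=
          mul_le_mul_of_nonneg_right e3 (hGpos x).le
      _ = M ^ 2 * ((2 * ‖x‖ + 1) * gaussVortexProfile x) := by ring
      _ ≤ M ^ 2 * ((3 * (1 + ‖x‖) ^ 2) * gaussVortexProfile x) := by
          gcongr
          · exact (hGpos x).le
          · nlinarith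
      _ = 3 * M ^ 2 * ((1 + ‖x‖) ^ 2 * gaussVortexProfile x) := by ring
  have ibp : ∀ i : Fin 2, ∫ x, x i ^ 2 / 2 * u x ^ 2 * gaussVortexProfile x =
      ∫ x, (2 * u x * fderiv ℝ u x (EuclideanSpace.single i 1) * x i + u x ^ 2) * gaussVortexProfile x := by
    intro i
    set f : EuclideanSpace ℝ (Fin 2) → ℝ := fun x => u x ^ 2 * x i with hf
    have hcoord : ∀ x : EuclideanSpace ℝ (Fin 2), HasFDerivAt (fun y : EuclideanSpace ℝ (Fin 2) => y i)
        (EuclideanSpace.proj i : EuclideanSpace ℝ (Fin 2) →L[ℝ] ℝ) x := fun x =>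
      (EuclideanSpace.proj i : EuclideanSpace ℝ (Fin 2) →L[ℝ] ℝ).hasFDerivAt
    have hfd : ∀ x, HasFDerivAt f ((u x ^ 2) • (EuclideanSpace.proj i : EuclideanSpace ℝ (Fin 2) →L[ℝ] ℝ) +
        (x i) • ((2 * u x) • fderiv ℝ u x)) x := by
      intro x
      have h2 : HasFDerivAt (fun y => u y ^ 2) ((2 * u x) • fderiv ℝ u x) x := by
        simpa using (hud x).pow 2
      exact h2.mul (hcoord x)
    have hf' : ∀ x, fderiv ℝ f x (EuclideanSpace.single i 1) =
        2 * u x * fderiv ℝ u x (EuclideanSpace.single i 1) * x i + u x ^ 2 := by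
      intro x
      rw [(hfd x).fderiv]
      simp
      ring
    have hfc : Continuous f := (huc.pow 2).mul (PiLp.continuous_apply 2 _ i)
    have i1 : Integrable fun x => fderiv ℝ f x (EuclideanSpace.single i 1) * gaussVortexProfile x := by
      simp_rw [hf']; exact iR i
    have i2 : Integrable fun x => f x * fderiv ℝ gaussVortexProfile x (EuclideanSpace.single i 1) := by
      simp_rw [fderiv_gauss_single]
      refine integrable_of_abs_le_mul_gauss (hfc.mul (((PiLp.continuous_apply 2 _ i).div_const _).neg.mul hGc))
        (M ^ 2) fun x => ?_
      simp only [hf]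
      rw [show u x ^ 2 * x i * (-(x i / 2) * gaussVortexProfile x) =
        -(u x ^ 2 * x i ^ 2 * gaussVortexProfile x / 2) by ring, abs_neg,
        abs_of_nonneg (by positivity [hGpos x])]
      have hux : u x ^ 2 ≤ M ^ 2 := by
        rw [← sq_abs]; exact pow_le_pow_left₀ (abs_nonneg _) (h0 x) 2
      have hx2 : x i ^ 2 ≤ ‖x‖ ^ 2 := by
        rw [← sq_abs]; exact pow_le_pow_left₀ (abs_nonneg _) (hxi x i) 2
      obtain ⟨-, -, h3⟩ := le_one_add_sq_of_nonneg (norm_nonneg x)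
      calc u x ^ 2 * x i ^ 2 * gaussVortexProfile x / 2 ≤ u x ^ 2 * x i ^ 2 * gaussVortexProfile x := by
            have : 0 ≤ u x ^ 2 * x i ^ 2 * gaussVortexProfile x := by positivity [hGpos x]
            linarith
        _ ≤ M ^ 2 * (1 + ‖x‖) ^ 2 * gaussVortexProfile x :=
            mul_le_mul_of_nonneg_right (mul_le_mul hux (hx2.trans h3) (sq_nonneg _) (sq_nonneg M))
              (hGpos x).le
        _ = M ^ 2 * ((1 + ‖x‖) ^ 2 * gaussVortexProfile x) := by ring
    have i3 : Integrable fun x => f x * gaussVortexProfile x := by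
      refine integrable_of_abs_le_mul_gauss (hfc.mul hGc) (M ^ 2) fun x => ?_
      simp only [hf]
      rw [abs_mul, abs_mul, abs_of_pos (hGpos x), abs_pow, sq_abs]
      have hux : u x ^ 2 ≤ M ^ 2 := by
        rw [← sq_abs]; exact pow_le_pow_left₀ (abs_nonneg _) (h0 x) 2
      obtain ⟨-, h3, -⟩ := le_one_add_sq_of_nonneg (norm_nonneg x)
      calc u x ^ 2 * |x i| * gaussVortexProfile x ≤ M ^ 2 * (1 + ‖x‖) ^ 2 * gaussVortexProfile x :=
            mul_le_mul_of_nonneg_right (mul_le_mul hux ((hxi x i).trans h3) (abs_nonneg _) (sq_nonneg M))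
              (hGpos x).le
        _ = M ^ 2 * ((1 + ‖x‖) ^ 2 * gaussVortexProfile x) := by ring
    have hibp := integral_mul_fderiv_eq_neg_fderiv_mul_of_integrable i1 i2 i3
      (fun x _ => (hfd x).differentiableAt) (fun x _ => (hGd x).differentiableAt)
    calc ∫ x, x i ^ 2 / 2 * u x ^ 2 * gaussVortexProfile x
        = -∫ x, f x * fderiv ℝ gaussVortexProfile x (EuclideanSpace.single i 1) := by
          rw [← integral_neg]
          refine integral_congr_ae (Eventually.of_forall fun x => ?_)
          simp only [hf]
          rw [fderiv_gauss_single]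
          ring
      _ = ∫ x, fderiv ℝ f x (EuclideanSpace.single i 1) * gaussVortexProfile x := by rw [hibp, neg_neg]
      _ = _ := integral_congr_ae (Eventually.of_forall fun x => by simp only [hf'])
  -- sum over the two coordinates and Young
  have iL : ∀ i : Fin 2, Integrable fun x : EuclideanSpace ℝ (Fin 2) =>
      x i ^ 2 / 2 * u x ^ 2 * gaussVortexProfile x := fun i => by
    refine integrable_of_abs_le_mul_gauss (((((PiLp.continuous_apply 2 _ i).pow 2).div_const _).mul
      (huc.pow 2)).mul hGc) (M ^ 2) fun x => ?_
    rw [abs_of_nonneg (by positivity [hGpos x])]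
    have hux : u x ^ 2 ≤ M ^ 2 := by
      rw [← sq_abs]; exact pow_le_pow_left₀ (abs_nonneg _) (h0 x) 2
    have hx2 : x i ^ 2 ≤ ‖x‖ ^ 2 := by
      rw [← sq_abs]; exact pow_le_pow_left₀ (abs_nonneg _) (hxi x i) 2
    obtain ⟨-, -, h3⟩ := le_one_add_sq_of_nonneg (norm_nonneg x)
    calc x i ^ 2 / 2 * u x ^ 2 * gaussVortexProfile x ≤ x i ^ 2 * u x ^ 2 * gaussVortexProfile x := by
          have : 0 ≤ x i ^ 2 * u x ^ 2 * gaussVortexProfile x := by positivity [hGpos x]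
          linarith
      _ ≤ (1 + ‖x‖) ^ 2 * M ^ 2 * gaussVortexProfile x :=
          mul_le_mul_of_nonneg_right (mul_le_mul (hx2.trans h3) hux (sq_nonneg _) (by positivity))
            (hGpos x).le
      _ = M ^ 2 * ((1 + ‖x‖) ^ 2 * gaussVortexProfile x) := by ring
  have hsum : (1 / 2 : ℝ) * ∫ x, ‖x‖ ^ 2 * u x ^ 2 * gaussVortexProfile x =
      ∫ x, ((2 * u x * fderiv ℝ u x (EuclideanSpace.single 0 1) * x 0 + u x ^ 2) * gaussVortexProfile x +
        (2 * u x * fderiv ℝ u x (EuclideanSpace.single 1 1) * x 1 + u x ^ 2) * gaussVortexProfile x) := by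
    rw [integral_add (iR 0) (iR 1), ← ibp 0, ← ibp 1, ← integral_add (iL 0) (iL 1), ← integral_const_mul]
    refine integral_congr_ae (Eventually.of_forall fun x => ?_)
    simp only [EuclideanSpace.real_norm_sq_eq, Fin.sum_univ_two]
    ring
  have hpt : ∀ x, (2 * u x * fderiv ℝ u x (EuclideanSpace.single 0 1) * x 0 + u x ^ 2) * gaussVortexProfile x +
        (2 * u x * fderiv ℝ u x (EuclideanSpace.single 1 1) * x 1 + u x ^ 2) * gaussVortexProfile x ≤
      (1 / 4 : ℝ) * (‖x‖ ^ 2 * u x ^ 2 * gaussVortexProfile x) + 4 * (gaussVortexProfile x * ‖fderiv ℝ u x‖ ^ 2) +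
        2 * (gaussVortexProfile x * u x ^ 2) := by
    intro x
    have hlin : 2 * u x * fderiv ℝ u x (EuclideanSpace.single 0 1) * x 0 +
        2 * u x * fderiv ℝ u x (EuclideanSpace.single 1 1) * x 1 = 2 * u x * fderiv ℝ u x x := by
      rw [fderiv_apply_self_eq_coord']; ring
    have hy : 2 * u x * fderiv ℝ u x x ≤ (1 / 4 : ℝ) * (‖x‖ ^ 2 * u x ^ 2) + 4 * ‖fderiv ℝ u x‖ ^ 2 := by
      have ha : |u x * fderiv ℝ u x x| ≤ |u x| * ‖x‖ * ‖fderiv ℝ u x‖ := by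
        rw [abs_mul]
        calc |u x| * |fderiv ℝ u x x| ≤ |u x| * (‖fderiv ℝ u x‖ * ‖x‖) :=
              mul_le_mul_of_nonneg_left (hDux x) (abs_nonneg _)
          _ = |u x| * ‖x‖ * ‖fderiv ℝ u x‖ := by ring
      have hb : u x * fderiv ℝ u x x ≤ |u x| * ‖x‖ * ‖fderiv ℝ u x‖ := (le_abs_self _).trans ha
      have hsq : (|u x| * ‖x‖) ^ 2 = ‖x‖ ^ 2 * u x ^ 2 := by rw [mul_pow, sq_abs]; ring
      nlinarith [sq_nonneg (|u x| * ‖x‖ / 2 - 2 * ‖fderiv ℝ u x‖), hsq]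
    have hG := (hGpos x).le
    calc (2 * u x * fderiv ℝ u x (EuclideanSpace.single 0 1) * x 0 + u x ^ 2) * gaussVortexProfile x +
          (2 * u x * fderiv ℝ u x (EuclideanSpace.single 1 1) * x 1 + u x ^ 2) * gaussVortexProfile x
        = (2 * u x * fderiv ℝ u x x + 2 * u x ^ 2) * gaussVortexProfile x := by rw [← hlin]; ring
      _ ≤ ((1 / 4 : ℝ) * (‖x‖ ^ 2 * u x ^ 2) + 4 * ‖fderiv ℝ u x‖ ^ 2 + 2 * u x ^ 2) * gaussVortexProfile x :=
          mul_le_mul_of_nonneg_right (by linarith) hG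
      _ = _ := by ring
  have i12 : Integrable fun x =>
      (2 * u x * fderiv ℝ u x (EuclideanSpace.single 0 1) * x 0 + u x ^ 2) * gaussVortexProfile x +
        (2 * u x * fderiv ℝ u x (EuclideanSpace.single 1 1) * x 1 + u x ^ 2) * gaussVortexProfile x :=
    (iR 0).add (iR 1)
  have iMA : Integrable fun x : EuclideanSpace ℝ (Fin 2) =>
      (1 / 4 : ℝ) * (‖x‖ ^ 2 * u x ^ 2 * gaussVortexProfile x) + 4 * (gaussVortexProfile x * ‖fderiv ℝ u x‖ ^ 2) :=
    (iM.const_mul _).add (iA.const_mul _)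
  have iMAB : Integrable fun x : EuclideanSpace ℝ (Fin 2) =>
      (1 / 4 : ℝ) * (‖x‖ ^ 2 * u x ^ 2 * gaussVortexProfile x) + 4 * (gaussVortexProfile x * ‖fderiv ℝ u x‖ ^ 2) +
        2 * (gaussVortexProfile x * u x ^ 2) :=
    iMA.add (iB.const_mul _)
  have hmono := integral_mono i12 iMAB hpt
  rw [integral_add iMA (iB.const_mul _), integral_add (iM.const_mul _) (iA.const_mul _), integral_const_mul,
    integral_const_mul, integral_const_mul, ← hsum] at hmono
  linarith



/-- **Gaussian second moment controlled by the Dirichlet form** (registered helper toward `stub_coreInverse`):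
for `u ∈ C¹(ℝ²)` with `u, Du` bounded, `∫ |ξ|² u² G ≤ 16 ∫ G ‖Du‖² + 8 ∫ G u²`. [folklore] -/
theorem coreL_second_moment :
    ∀ u : EuclideanSpace ℝ (Fin 2) → ℝ, ContDiff ℝ 1 u →
      (∃ M : ℝ, ∀ ξ, |u ξ| ≤ M ∧ ‖fderiv ℝ u ξ‖ ≤ M) →
      ∫ ξ, ‖ξ‖ ^ 2 * u ξ ^ 2 * gaussVortexProfile ξ ≤
        16 * (∫ ξ, gaussVortexProfile ξ * ‖fderiv ℝ u ξ‖ ^ 2) + 8 * ∫ ξ, gaussVortexProfile ξ * u ξ ^ 2 := by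
  intro u hu hM
  obtain ⟨M, hM⟩ := hM
  exact integral_norm_sq_mul_sq_mul_gaussVortexProfile_le hu (fun x => (hM x).1) fun x => (hM x).2

end Summit.AnomalousDissipation.AnomalousDissipation.Theorems.MarginalStabilityChainStretchedVortexRows

end
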